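import Summits.AnomalousDissipation.AnomalousDissipation.Theorems.SawtoothPulseCascadeK1LocalisedCascadeSlotExpansion
import Summits.AnomalousDissipation.AnomalousDissipation.Theorems.SawtoothPulseCascadeK1LocalisedCascadeSlotTwoBranch

/-!
# K1loc, line `Spectral` / SeqCone — helper: THE TWO-BRANCH ENERGY STEP WITH HIGHER-ORDER COMMUTATORS (T1/T2 brick)

Helper file of the prover lane on the crux `K1LocalisedCascade` (stmt-AnomalousDissipation-19491), route
`SawtoothPulseCascade` (NOTES "T2 FINDING").  The two-branch energy step `…SlotTwoBranch.tsum_symbol_sq_twoBranch_le`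
charges the branches and the cross term with FIRST-order `ω`/`ω₂`-moments; here the same step is run on the
higher-order expansion of `…SlotExpansion`: the branch energies cost `Σ_{α<r} B_α ‖m_α(·+q^±)(D)F‖ + L W^± ‖F‖`
(`sqrt_tsum_symbol_sq_branch_le_of_expansion`), and the cross term — all lower-order terms vanishing exactly because the
derivative multipliers `Ξ⁺_α` are disjoint from `Ξ⁻` — costs only the remainder `L₂ W₂ ‖F‖²`
(`norm_tsum_symbol_sq_cross_le_of_expansion`).  Assembled: `tsum_symbol_sq_twoBranch_le_of_expansion`, via the abstract
two-piece bookkeeping `tsum_symbol_sq_add_le_of_bounds`.  No definitions; no statement about the stub.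
[cite: Grafakos2014, Prop. 3.1.2 (5) (coefficients of products, translations and modulations) and Prop. 3.2.7 (3)
(Parseval)] [problem: turb]
-/

-- `Summit.<Summit>.<Problem>`: single-conjunct summit, the duplicate namespace segment is deliberate.
set_option linter.dupNamespace false

noncomputable section

namespace Summit.AnomalousDissipation.AnomalousDissipation.Theorems.SawtoothPulseCascade.K1Slot

open MeasureTheory Set Filter Topology UnitAddTorus Complex
open scoped ComplexConjugate
open Literature.Analysis Literature.Analysis.FunctionSpaces Literature.Analysis.FluidPDE
open Literature.Analysis.FunctionSpaces.Torus
open Literature.Analysis.FluidPDE.ScalarFourier (lconv lconv_apply)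
open Summit.AnomalousDissipation.AnomalousDissipation.Theorems.SawtoothPulseCascade.SpectralLeakage

variable {d : Type*} [Fintype d]

/-! ## Abstract two-piece bookkeeping -/

/-- **Weighted energy of a two-piece sum from bounds on the pieces and on the cross term**: for continuous `P, Q`, a
bounded real symbol `m`, `√Σ m²|𝓕P|² ≤ X⁺`, `√Σ m²|𝓕Q|² ≤ X⁻` and `|Σ m² 𝓕P conj 𝓕Q| ≤ c`:
`Σ m²|𝓕(P+Q)|² ≤ X⁺² + X⁻² + 2c`. [cite: Grafakos2014, Prop. 3.2.7 (3)] -/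
theorem tsum_symbol_sq_add_le_of_bounds {P Q : UnitAddTorus d → ℂ} (hP : Continuous P) (hQ : Continuous Q)
    {m : (d → ℤ) → ℝ} {M : ℝ} (hmM : ∀ k, |m k| ≤ M) {Xp Xm c : ℝ}
    (hXp : Real.sqrt (∑' k, m k ^ 2 * ‖mFourierCoeff P k‖ ^ 2) ≤ Xp)
    (hXm : Real.sqrt (∑' k, m k ^ 2 * ‖mFourierCoeff Q k‖ ^ 2) ≤ Xm)
    (hc : ‖∑' k, ((m k ^ 2 : ℝ) : ℂ) * mFourierCoeff P k * conj (mFourierCoeff Q k)‖ ≤ c) :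
    ∑' k, m k ^ 2 * ‖mFourierCoeff (fun x => P x + Q x) k‖ ^ 2 ≤ Xp ^ 2 + Xm ^ 2 + 2 * c := by
  have hM0 : 0 ≤ M := (abs_nonneg _).trans (hmM 0)
  have hm2 : ∀ k, m k ^ 2 ≤ M ^ 2 := fun k => by
    rw [← sq_abs]; exact pow_le_pow_left₀ (abs_nonneg _) (hmM k) 2
  set a : (d → ℤ) → ℂ := mFourierCoeff P with ha_def
  set b : (d → ℤ) → ℂ := mFourierCoeff Q with hb_def
  have hPa := hasSum_sq_mFourierCoeff_of_continuous hP
  have hPb := hasSum_sq_mFourierCoeff_of_continuous hQ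
  have ha : Summable fun k => m k ^ 2 * ‖a k‖ ^ 2 :=
    (hPa.summable.mul_left (M ^ 2)).of_nonneg_of_le (fun k => by positivity)
      fun k => mul_le_mul_of_nonneg_right (hm2 k) (sq_nonneg _)
  have hb : Summable fun k => m k ^ 2 * ‖b k‖ ^ 2 :=
    (hPb.summable.mul_left (M ^ 2)).of_nonneg_of_le (fun k => by positivity)
      fun k => mul_le_mul_of_nonneg_right (hm2 k) (sq_nonneg _)
  -- the cross family is summable (square-summable `m² a` and `b`)
  have hu : Summable fun k => ‖((m k ^ 2 : ℝ) : ℂ) * a k‖ ^ 2 :=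
    (hPa.summable.mul_left ((M ^ 2) ^ 2)).of_nonneg_of_le (fun k => by positivity) fun k => by
      rw [norm_mul, mul_pow, Complex.norm_real, Real.norm_eq_abs, abs_of_nonneg (sq_nonneg _)]
      exact mul_le_mul_of_nonneg_right (pow_le_pow_left₀ (sq_nonneg _) (hm2 k) 2) (sq_nonneg _)
  obtain ⟨hab, _⟩ := norm_tsum_mul_conj_le hu hPb.summable
  obtain ⟨_, heq⟩ := tsum_symbol_sq_norm_add ha hb hab
  have hadd : ∀ k, mFourierCoeff (fun x => P x + Q x) k = a k + b k := fun k =>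
    mFourierCoeff_add hP.integrable_unitAddTorus hQ.integrable_unitAddTorus k
  simp_rw [hadd]
  rw [heq]
  have h1 : ∑' k, m k ^ 2 * ‖a k‖ ^ 2 ≤ Xp ^ 2 := by
    have h0 : 0 ≤ ∑' k, m k ^ 2 * ‖a k‖ ^ 2 := tsum_nonneg fun k => by positivity
    calc ∑' k, m k ^ 2 * ‖a k‖ ^ 2 = (Real.sqrt (∑' k, m k ^ 2 * ‖a k‖ ^ 2)) ^ 2 := (Real.sq_sqrt h0).symm
      _ ≤ Xp ^ 2 := pow_le_pow_left₀ (Real.sqrt_nonneg _) hXp 2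
  have h2 : ∑' k, m k ^ 2 * ‖b k‖ ^ 2 ≤ Xm ^ 2 := by
    have h0 : 0 ≤ ∑' k, m k ^ 2 * ‖b k‖ ^ 2 := tsum_nonneg fun k => by positivity
    calc ∑' k, m k ^ 2 * ‖b k‖ ^ 2 = (Real.sqrt (∑' k, m k ^ 2 * ‖b k‖ ^ 2)) ^ 2 := (Real.sq_sqrt h0).symm
      _ ≤ Xm ^ 2 := pow_le_pow_left₀ (Real.sqrt_nonneg _) hXm 2
  have h3 : (∑' k, ((m k ^ 2 : ℝ) : ℂ) * a k * conj (b k)).re ≤ c :=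
    (Complex.re_le_norm _).trans hc
  linarith

/-! ## The branch energies -/

/-- **Branch energy with higher-order commutators**: for `P = e_q Ξ F`,
`√Σ m²|𝓕P|² = √Σ m(k+q)²|𝓕(ΞF)(k)|² ≤ Σ_{α<r} B_α √Σ‖m_α(k+q)‖²|𝓕F(k)|² + L (Σρ|𝓕Ξ|) ‖F‖`
(shift rule and `sqrt_tsum_symbol_sq_mul_le_of_expansion` for the shifted symbol, whose Taylor data are the shifted
data). [cite: Grafakos2014, Prop. 3.1.2 (5) and Prop. 3.2.7 (3)] -/
theorem sqrt_tsum_symbol_sq_branch_le_of_expansion {F Ξ : UnitAddTorus d → ℂ} (hF : Continuous F)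
    (hFs : Summable fun k => ‖mFourierCoeff F k‖) (hΞ : Continuous Ξ) (hΞs : Summable fun q => ‖mFourierCoeff Ξ q‖)
    (q₀ : d → ℤ) (j : d) (r : ℕ) {Ξd : ℕ → UnitAddTorus d → ℂ} (hΞd_c : ∀ α ∈ Finset.range r, Continuous (Ξd α))
    (hΞd_s : ∀ α ∈ Finset.range r, Summable fun q => ‖mFourierCoeff (Ξd α) q‖)
    (hΞd : ∀ α ∈ Finset.range r, ∀ q, mFourierCoeff (Ξd α) q = (2 * Real.pi * I * (q j : ℂ)) ^ α * mFourierCoeff Ξ q)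
    {B : ℕ → ℝ} (hB : ∀ α ∈ Finset.range r, ∀ x, ‖Ξd α x‖ ≤ B α)
    {m : (d → ℤ) → ℝ} {md : ℕ → (d → ℤ) → ℂ} {Md : ℝ} (hMd : ∀ α ∈ Finset.range r, ∀ k, ‖md α k‖ ≤ Md)
    {ρ : (d → ℤ) → ℝ} {L : ℝ} (hρ0 : ∀ q, 0 ≤ ρ q) (hL : 0 ≤ L)
    (hT : ∀ k q, mFourierCoeff Ξ q ≠ 0 →
      ‖(m k : ℂ) - ∑ α ∈ Finset.range r, (2 * Real.pi * I * (q j : ℂ)) ^ α * md α (k - q)‖ ≤ L * ρ q)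
    (hρs : Summable fun q => ρ q * ‖mFourierCoeff Ξ q‖) :
    Real.sqrt (∑' k, m k ^ 2 * ‖mFourierCoeff (fun x => mFourier q₀ x * (Ξ x * F x)) k‖ ^ 2) ≤
      ∑ α ∈ Finset.range r, B α * Real.sqrt (∑' k, ‖md α (k + q₀)‖ ^ 2 * ‖mFourierCoeff F k‖ ^ 2) +
        L * (∑' q, ρ q * ‖mFourierCoeff Ξ q‖) * Real.sqrt (∫ x, ‖F x‖ ^ 2) := by
  rw [tsum_symbol_sq_mFourier_mul]
  have hT' : ∀ k q, mFourierCoeff Ξ q ≠ 0 →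
      ‖((m (k + q₀) : ℝ) : ℂ) - ∑ α ∈ Finset.range r, (2 * Real.pi * I * (q j : ℂ)) ^ α * md α (k - q + q₀)‖ ≤ L * ρ q := by
    intro k q hq
    simpa only [sub_add_eq_add_sub] using hT (k + q₀) q hq
  exact sqrt_tsum_symbol_sq_mul_le_of_expansion hF hFs hΞ hΞs j r hΞd_c hΞd_s hΞd hB (m := fun k => m (k + q₀))
    (md := fun α k => md α (k + q₀)) (fun α hα k => hMd α hα _) hρ0 hL hT' hρs

/-! ## The cross term -/

/-- **Cross term with higher-order commutators.**  For disjoint localisers — every derivative multiplier `Ξ⁺_α` of `Ξ⁺`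
disjoint from `Ξ⁻` (`conj(Ξ⁺_α)·Ξ⁻ = 0`), `‖Ξ⁻‖ ≤ 1` — and Taylor data of order `r` for the SQUARED shifted symbol
`k ↦ m(k+q⁺)²` on the spectrum of `Ξ⁺`:
`|Σ m² 𝓕(e_{q⁺}Ξ⁺F) conj 𝓕(e_{q⁻}Ξ⁻F)| ≤ L₂ (Σρ₂|𝓕Ξ⁺|) ∫‖F‖²`
(reindexing, the expansion identity, exact vanishing of the lower-order terms by disjointness, Cauchy–Schwarz for the
remainder). [cite: Grafakos2014, Prop. 3.1.2 (5) and Prop. 3.2.7 (3)] -/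
theorem norm_tsum_symbol_sq_cross_le_of_expansion {F Ξp Ξm : UnitAddTorus d → ℂ} (hF : Continuous F)
    (hFs : Summable fun k => ‖mFourierCoeff F k‖) (hΞp : Continuous Ξp) (hΞps : Summable fun q => ‖mFourierCoeff Ξp q‖)
    (hΞm : Continuous Ξm) (hΞm1 : ∀ x, ‖Ξm x‖ ≤ 1) (qp qm : d → ℤ) (j : d) (r : ℕ)
    {Ξpd : ℕ → UnitAddTorus d → ℂ} (hΞpd_c : ∀ α ∈ Finset.range r, Continuous (Ξpd α))
    (hΞpd_s : ∀ α ∈ Finset.range r, Summable fun q => ‖mFourierCoeff (Ξpd α) q‖)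
    (hΞpd : ∀ α ∈ Finset.range r, ∀ q, mFourierCoeff (Ξpd α) q = (2 * Real.pi * I * (q j : ℂ)) ^ α * mFourierCoeff Ξp q)
    (hdis : ∀ α ∈ Finset.range r, ∀ x, conj (Ξpd α x) * Ξm x = 0)
    {m : (d → ℤ) → ℝ} {μd : ℕ → (d → ℤ) → ℂ} {Md : ℝ} (hMd : ∀ α ∈ Finset.range r, ∀ k, ‖μd α k‖ ≤ Md)
    {ρ : (d → ℤ) → ℝ} {L : ℝ} (hρ0 : ∀ q, 0 ≤ ρ q) (hL : 0 ≤ L)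
    (hT : ∀ k q, mFourierCoeff Ξp q ≠ 0 →
      ‖((m (k + qp) ^ 2 : ℝ) : ℂ) - ∑ α ∈ Finset.range r, (2 * Real.pi * I * (q j : ℂ)) ^ α * μd α (k - q)‖ ≤ L * ρ q)
    (hρs : Summable fun q => ρ q * ‖mFourierCoeff Ξp q‖) :
    ‖∑' k, ((m k ^ 2 : ℝ) : ℂ) * mFourierCoeff (fun x => mFourier qp x * (Ξp x * F x)) k *
        conj (mFourierCoeff (fun x => mFourier qm x * (Ξm x * F x)) k)‖ ≤
      L * (∑' q, ρ q * ‖mFourierCoeff Ξp q‖) * ∫ x, ‖F x‖ ^ 2 := by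
  classical
  rw [tsum_cross_reindex]
  -- the second localiser, modulated
  set Θ₂ : UnitAddTorus d → ℂ := fun x => mFourier (qm - qp) x * Ξm x with hΘ₂_def
  have hΘ₂ : Continuous Θ₂ := (mFourier (qm - qp)).continuous.mul hΞm
  have hΘ₂1 : ∀ x, ‖Θ₂ x‖ ≤ 1 := fun x => by
    rw [hΘ₂_def, norm_mul]
    have h1 : ‖mFourier (qm - qp) x‖ = 1 := by
      rw [Torus.mFourier_apply_eq_prod, norm_prod]
      exact Finset.prod_eq_one fun l _ => Circle.norm_coe _
    rw [h1, one_mul]; exact hΞm1 x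
  have hdis' : ∀ α ∈ Finset.range r, ∀ x, conj (Θ₂ x) * Ξpd α x = 0 := fun α hα x => by
    have h := congrArg conj (hdis α hα x)
    rw [map_mul, Complex.conj_conj, map_zero] at h
    rw [hΘ₂_def, map_mul, show conj (mFourier (qm - qp) x) * conj (Ξm x) * Ξpd α x =
      conj (mFourier (qm - qp) x) * (Ξpd α x * conj (Ξm x)) by ring, h, mul_zero]
  have e : (fun x => mFourier (qm - qp) x * (Ξm x * F x)) = fun x => Θ₂ x * F x := by
    funext x; simp only [hΘ₂_def]; ring
  rw [e]
  -- expansion of `m(k+q⁺)² 𝓕(Ξ⁺F)(k)`: the remainder family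
  obtain ⟨_, hRs, hR⟩ := sqrt_tsum_sq_kernel_le hF hFs (c := mFourierCoeff Ξp)
    (fun k q => ((m (k + qp) ^ 2 : ℝ) : ℂ) - ∑ α ∈ Finset.range r, (2 * Real.pi * I * (q j : ℂ)) ^ α * μd α (k - q))
    hρ0 hL hT hρs
  set f : (d → ℤ) → ℂ := mFourierCoeff F with hf_def
  set R : (d → ℤ) → ℂ := fun k => ∑' q, mFourierCoeff Ξp q *
    ((((m (k + qp) ^ 2 : ℝ) : ℂ) - ∑ α ∈ Finset.range r, (2 * Real.pi * I * (q j : ℂ)) ^ α * μd α (k - q)) * f (k - q))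
    with hR_def
  -- the second branch
  have hvc : Continuous fun x => Θ₂ x * F x := hΘ₂.mul hF
  set v : (d → ℤ) → ℂ := mFourierCoeff (fun x => Θ₂ x * F x) with hv_def
  have hvP := hasSum_sq_mFourierCoeff_of_continuous hvc
  have hv2 : ∑' k, ‖v k‖ ^ 2 ≤ ∫ x, ‖F x‖ ^ 2 := by
    rw [hv_def, hvP.tsum_eq]
    calc ∫ x, ‖Θ₂ x * F x‖ ^ 2 ≤ 1 ^ 2 * ∫ x, ‖F x‖ ^ 2 := integral_norm_sq_mul_le hF hΘ₂1
      _ = ∫ x, ‖F x‖ ^ 2 := by rw [one_pow, one_mul]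
  have hh : ∀ α ∈ Finset.range r, Summable fun k => ‖μd α k * f k‖ := fun α hα =>
    (hFs.mul_left Md).of_nonneg_of_le (fun _ => norm_nonneg _) fun k => by
      rw [norm_mul]; exact mul_le_mul_of_nonneg_right (hMd α hα k) (norm_nonneg _)
  have hH_c : ∀ α ∈ Finset.range r, Continuous (fourierSynth fun k => μd α k * f k) := fun α hα =>
    continuous_fourierSynth (hh α hα)
  set Pc : ℕ → (d → ℤ) → ℂ := fun α k => mFourierCoeff (fun x => Ξpd α x * fourierSynth (fun k => μd α k * f k) x) k
    with hPc_def
  have hP_c : ∀ α ∈ Finset.range r, Continuous (fun x => Ξpd α x * fourierSynth (fun k => μd α k * f k) x) :=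
    fun α hα => (hΞpd_c α hα).mul (hH_c α hα)
  have hid : ∀ k, ((m (k + qp) ^ 2 : ℝ) : ℂ) * mFourierCoeff (fun x => Ξp x * F x) k =
      ∑ α ∈ Finset.range r, Pc α k + R k := by
    intro k
    have h := symbol_mul_product_expansion hF hFs hΞp hΞps j r hΞpd_c hΞpd_s hΞpd (fun k => m (k + qp) ^ 2) hMd k
    rw [sub_eq_iff_eq_add'] at h
    exact h
  -- the lower-order terms are orthogonal to the second branch
  have hPorth : ∀ α ∈ Finset.range r, ∑' k, Pc α k * conj (v k) = 0 := by
    intro α hα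
    have h0 := tsum_conj_mFourierCoeff_mul_eq_zero_of_disjoint (H := F) (G := fourierSynth fun k => μd α k * f k)
      hΘ₂ (hΞpd_c α hα) hF (hH_c α hα) (hdis' α hα)
    rw [← h0]
    exact tsum_congr fun k => by rw [hPc_def, hv_def, mul_comm]
  -- summability of the pieces of the cross family
  have hPs : ∀ α ∈ Finset.range r, Summable fun k => Pc α k * conj (v k) := fun α hα =>
    (norm_tsum_mul_conj_le (hasSum_sq_mFourierCoeff_of_continuous (hP_c α hα)).summable hvP.summable).1
  obtain ⟨hRv, hRv_le⟩ := norm_tsum_mul_conj_le hRs hvP.summable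
  -- assemble
  have hsplit : ∑' k, ((m (k + qp) ^ 2 : ℝ) : ℂ) * mFourierCoeff (fun x => Ξp x * F x) k * conj (v k) =
      ∑ α ∈ Finset.range r, ∑' k, Pc α k * conj (v k) + ∑' k, R k * conj (v k) := by
    have h1 : ∀ k, ((m (k + qp) ^ 2 : ℝ) : ℂ) * mFourierCoeff (fun x => Ξp x * F x) k * conj (v k) =
        ∑ α ∈ Finset.range r, Pc α k * conj (v k) + R k * conj (v k) := fun k => by
      rw [hid k, add_mul, Finset.sum_mul]
    simp_rw [h1]
    rw [(summable_sum fun α hα => hPs α hα).tsum_add hRv, Summable.tsum_finsetSum hPs]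
  rw [hsplit, Finset.sum_eq_zero hPorth, zero_add]
  have hR0 : 0 ≤ L * ∑' q, ρ q * ‖mFourierCoeff Ξp q‖ :=
    mul_nonneg hL (tsum_nonneg fun q => mul_nonneg (hρ0 q) (norm_nonneg _))
  have hF0 : 0 ≤ ∫ x, ‖F x‖ ^ 2 := integral_nonneg fun x => by positivity
  calc ‖∑' k, R k * conj (v k)‖ ≤ Real.sqrt (∑' k, ‖R k‖ ^ 2) * Real.sqrt (∑' k, ‖v k‖ ^ 2) := hRv_le
    _ ≤ (L * (∑' q, ρ q * ‖mFourierCoeff Ξp q‖) * Real.sqrt (∫ x, ‖F x‖ ^ 2)) * Real.sqrt (∫ x, ‖F x‖ ^ 2) :=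
        mul_le_mul hR (Real.sqrt_le_sqrt hv2) (Real.sqrt_nonneg _) (mul_nonneg hR0 (Real.sqrt_nonneg _))
    _ = L * (∑' q, ρ q * ‖mFourierCoeff Ξp q‖) * ∫ x, ‖F x‖ ^ 2 := by
        rw [mul_assoc, Real.mul_self_sqrt hF0]

/-! ## The two-branch step, assembled -/

/-- **The two-branch energy step with higher-order commutators.**  For `H = e_{q⁺}Ξ⁺F + e_{q⁻}Ξ⁻F` with disjoint
localisers (`‖Ξ^±‖ ≤ 1`, every derivative multiplier of `Ξ⁺` disjoint from `Ξ⁻`), expansion data of order `r` for the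
symbol `m` on the spectra of `Ξ⁺` and `Ξ⁻` and for the squared shifted symbol `m(·+q⁺)²` on the spectrum of `Ξ⁺`:
`Σ m²|𝓕H|² ≤ X⁺² + X⁻² + 2 L₂ W₂ ‖F‖²`, `X^± = Σ_{α<r} B^±_α √Σ‖m_α(k+q^±)‖²|𝓕F(k)|² + L W^± ‖F‖`
(`W^± = Σρ|𝓕Ξ^±|`, `W₂ = Σρ₂|𝓕Ξ⁺|`). [cite: Grafakos2014, Prop. 3.1.2 (5) and Prop. 3.2.7 (3)] -/
theorem tsum_symbol_sq_twoBranch_le_of_expansion {F Ξp Ξm : UnitAddTorus d → ℂ} (hF : Continuous F)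
    (hFs : Summable fun k => ‖mFourierCoeff F k‖) (hΞp : Continuous Ξp) (hΞps : Summable fun q => ‖mFourierCoeff Ξp q‖)
    (hΞp1 : ∀ x, ‖Ξp x‖ ≤ 1) (hΞm : Continuous Ξm) (hΞms : Summable fun q => ‖mFourierCoeff Ξm q‖)
    (hΞm1 : ∀ x, ‖Ξm x‖ ≤ 1) (qp qm : d → ℤ) (j : d) (r : ℕ)
    {Ξpd Ξmd : ℕ → UnitAddTorus d → ℂ} (hΞpd_c : ∀ α ∈ Finset.range r, Continuous (Ξpd α))
    (hΞpd_s : ∀ α ∈ Finset.range r, Summable fun q => ‖mFourierCoeff (Ξpd α) q‖)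
    (hΞpd : ∀ α ∈ Finset.range r, ∀ q, mFourierCoeff (Ξpd α) q = (2 * Real.pi * I * (q j : ℂ)) ^ α * mFourierCoeff Ξp q)
    (hΞmd_c : ∀ α ∈ Finset.range r, Continuous (Ξmd α))
    (hΞmd_s : ∀ α ∈ Finset.range r, Summable fun q => ‖mFourierCoeff (Ξmd α) q‖)
    (hΞmd : ∀ α ∈ Finset.range r, ∀ q, mFourierCoeff (Ξmd α) q = (2 * Real.pi * I * (q j : ℂ)) ^ α * mFourierCoeff Ξm q)
    {Bp Bm : ℕ → ℝ} (hBp : ∀ α ∈ Finset.range r, ∀ x, ‖Ξpd α x‖ ≤ Bp α)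
    (hBm : ∀ α ∈ Finset.range r, ∀ x, ‖Ξmd α x‖ ≤ Bm α) (hdis : ∀ α ∈ Finset.range r, ∀ x, conj (Ξpd α x) * Ξm x = 0)
    {m : (d → ℤ) → ℝ} {M : ℝ} (hmM : ∀ k, |m k| ≤ M) {md μd : ℕ → (d → ℤ) → ℂ} {Md : ℝ}
    (hMd : ∀ α ∈ Finset.range r, ∀ k, ‖md α k‖ ≤ Md) (hμd : ∀ α ∈ Finset.range r, ∀ k, ‖μd α k‖ ≤ Md)
    {ρ ρ₂ : (d → ℤ) → ℝ} {L L₂ : ℝ} (hρ0 : ∀ q, 0 ≤ ρ q) (hρ₂0 : ∀ q, 0 ≤ ρ₂ q) (hL : 0 ≤ L) (hL₂ : 0 ≤ L₂)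
    (hT : ∀ k q, mFourierCoeff Ξp q ≠ 0 ∨ mFourierCoeff Ξm q ≠ 0 →
      ‖(m k : ℂ) - ∑ α ∈ Finset.range r, (2 * Real.pi * I * (q j : ℂ)) ^ α * md α (k - q)‖ ≤ L * ρ q)
    (hT₂ : ∀ k q, mFourierCoeff Ξp q ≠ 0 →
      ‖((m (k + qp) ^ 2 : ℝ) : ℂ) - ∑ α ∈ Finset.range r, (2 * Real.pi * I * (q j : ℂ)) ^ α * μd α (k - q)‖ ≤ L₂ * ρ₂ q)
    (hρp : Summable fun q => ρ q * ‖mFourierCoeff Ξp q‖) (hρm : Summable fun q => ρ q * ‖mFourierCoeff Ξm q‖)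
    (hρ₂ : Summable fun q => ρ₂ q * ‖mFourierCoeff Ξp q‖) :
    ∑' k, m k ^ 2 * ‖mFourierCoeff (fun x => mFourier qp x * (Ξp x * F x) + mFourier qm x * (Ξm x * F x)) k‖ ^ 2 ≤
      (∑ α ∈ Finset.range r, Bp α * Real.sqrt (∑' k, ‖md α (k + qp)‖ ^ 2 * ‖mFourierCoeff F k‖ ^ 2) +
          L * (∑' q, ρ q * ‖mFourierCoeff Ξp q‖) * Real.sqrt (∫ x, ‖F x‖ ^ 2)) ^ 2 +
        (∑ α ∈ Finset.range r, Bm α * Real.sqrt (∑' k, ‖md α (k + qm)‖ ^ 2 * ‖mFourierCoeff F k‖ ^ 2) +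
          L * (∑' q, ρ q * ‖mFourierCoeff Ξm q‖) * Real.sqrt (∫ x, ‖F x‖ ^ 2)) ^ 2 +
        2 * (L₂ * (∑' q, ρ₂ q * ‖mFourierCoeff Ξp q‖) * ∫ x, ‖F x‖ ^ 2) := by
  have hPp : Continuous fun x => mFourier qp x * (Ξp x * F x) := (mFourier qp).continuous.mul (hΞp.mul hF)
  have hPm : Continuous fun x => mFourier qm x * (Ξm x * F x) := (mFourier qm).continuous.mul (hΞm.mul hF)
  have hXp := sqrt_tsum_symbol_sq_branch_le_of_expansion hF hFs hΞp hΞps qp j r hΞpd_c hΞpd_s hΞpd hBp hMd hρ0 hL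
    (fun k q hq => hT k q (Or.inl hq)) hρp
  have hXm := sqrt_tsum_symbol_sq_branch_le_of_expansion hF hFs hΞm hΞms qm j r hΞmd_c hΞmd_s hΞmd hBm hMd hρ0 hL
    (fun k q hq => hT k q (Or.inr hq)) hρm
  have hc := norm_tsum_symbol_sq_cross_le_of_expansion hF hFs hΞp hΞps hΞm hΞm1 qp qm j r hΞpd_c hΞpd_s hΞpd hdis
    hμd hρ₂0 hL₂ hT₂ hρ₂
  have _ := hΞp1
  exact tsum_symbol_sq_add_le_of_bounds hPp hPm hmM hXp hXm hc

end Summit.AnomalousDissipation.AnomalousDissipation.Theorems.SawtoothPulseCascade.K1Slot
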